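import Summits.CriticalPhenomena.PercolationContinuityZ3.Theses.PercLowPointHalfSpace

/-!
# Sketch — crux-ideate round 2, ideator 4: `cerf-fresh-region-root-pairs`

Crux `BoundaryTwoArmDecay` (stmt-CriticalPhenomena-0911).  Signatures only (they elaborate; no
proof is claimed).  The lever: Cerf's fresh-region comparison (arXiv:1306.3105, Lemma 7.1),
transplanted to the half-space `H = {x₀ ≥ 0}` in the bond setting, converts a pair of DISJOINT
`n`-reaching wall clusters with DISTANT floor roots `u, v` (`|u - v| ≤ 2m`) into an adjacent
closed-edge two-arm event inside `Λ_{3m+1}(u) ∩ H`, at polynomial cost `m⁶ / q_m(u,v)` where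
`q_m(u,v) = P(u ↔ v in H ∩ Λ_{3m}(u))`.  With the level census this gives a scale-separated
bound on the density of lex-rooted tall clusters (the census residual `ν_n`) with NO one-arm rate.
-/

namespace Summit.CriticalPhenomena.PercolationContinuityZ3.Cruxes.BoundaryTwoArmDecay.CerfFreshRegion

open MeasureTheory
open Literature.Probability.Percolation Literature.Probability.LatticeModels

noncomputable section

/-- The half-space `H = {x₀ ≥ 0}`. -/
abbrev Hs : Set (Site 3) := {x : Site 3 | 0 ≤ x 0}

/-- The critical bond measure on `ℤ³`. -/
abbrev Pc : Measure (BondConfig (Site 3)) := bondPercolation (zdGraph 3) (criticalProbI 3)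

/-- `C_H(x)` reaches sup-distance `≥ r` from `x`. -/
def tallAt (x : Site 3) (r : ℕ) : Set (BondConfig (Site 3)) :=
  {ω | ∃ y : Site 3, (∃ i : Fin 3, (r : ℤ) ≤ |y i - x i|) ∧ ω ∈ openConnIn Hs x y}

/-- Two DISJOINT `r`-reaching half-space clusters rooted at (possibly distant) sites `u, v`. -/
def distantPair (u v : Site 3) (r : ℕ) : Set (BondConfig (Site 3)) :=
  tallAt u r ∩ tallAt v r ∩ (openConnIn Hs u v)ᶜ

/-- The closed-edge two-arm event at a lattice edge `{x, y}` of `H`: the edge is closed and the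
half-space clusters of its endpoints are distinct and both `r`-reaching (for `x = 0`, `y = e` this is
the crux event up to the null set `{ω ⊄ E(ℤ³)}`). -/
def edgeTwoArm (x y : Site 3) (r : ℕ) : Set (BondConfig (Site 3)) :=
  {ω | s(x, y) ∉ ω} ∩ distantPair x y r

/-- The crux event of the route (`BoundaryTwoArmDecay`), restated through `distantPair`
(roots `0` and `e = (0,1,0)`). -/
theorem crux_event_eq (r : ℕ) :
    {ω : BondConfig (Site 3) | (∃ y : Site 3, (∃ i : Fin 3, (r : ℤ) ≤ |y i|) ∧
        ω ∈ openConnIn {x : Site 3 | 0 ≤ x 0} 0 y) ∧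
      (∃ y : Site 3, (∃ i : Fin 3, (r : ℤ) ≤ |y i - (Pi.single 1 1 : Site 3) i|) ∧
        ω ∈ openConnIn {x : Site 3 | 0 ≤ x 0} (Pi.single 1 1 : Site 3) y) ∧
      ω ∉ openConnIn {x : Site 3 | 0 ≤ x 0} 0 (Pi.single 1 1 : Site 3)}
      = distantPair 0 (Pi.single 1 1) r := by
  ext ω
  simp only [distantPair, tallAt, Hs, Set.mem_inter_iff, Set.mem_setOf_eq, Set.mem_compl_iff,
    sub_zero, Pi.zero_apply]
  tauto

/-- A uniform bound `B` on closed-edge two-arms at lattice edges of `H` whose lower endpoint has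
height `≤ h`, with reach `r`. (By horizontal translation invariance only height and orientation
matter; stated as a hypothesis shape.) -/
def EdgeTwoArmBound (h r : ℕ) (B : ℝ) : Prop :=
  ∀ x y : Site 3, (zdGraph 3).Adj x y → x ∈ Hs → y ∈ Hs → x 0 ≤ (h : ℤ) →
    Pc.real (edgeTwoArm x y r) ≤ B

/-- **First lemma (half-space Cerf comparison, bond version of arXiv:1306.3105 Lemma 7.1).**
For floor roots `u, v` at sup-distance `≤ 2m` and reach `n ≥ 8m`:
`P(distantPair u v n) · q ≤ C m³ B + C m⁶ B / p_c` whenever `q ≤ P(u ↔ v in H ∩ Λ_{3m}(u))` and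
`B` bounds the closed-edge two-arms of height `≤ 3m+1` and reach `n - 6m`.  Proof content:
condition on the two clusters `A = C_H(u)`, `B' = C_H(v)` (a stopping pair); if they are adjacent
inside `Λ_{3m}(u)` a two-arm edge is already present (first term); otherwise every open `u–v` path
inside `Λ_{3m}(u) ∩ H` contains a sub-path from `∂A` to `∂B'` using only edges NOT incident to
`A ∪ B'` (fresh, independent of the clusters), so this happens with conditional probability `≥ q`;
opening the one closed edge from the fresh path into `B'` produces a closed-edge two-arm at the
`A`-end (second term, `1/p_c` for the surgery, `m⁶` for the union over the two ends). -/
def CerfComparison : Prop :=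
  ∃ C : ℝ, 0 < C ∧ ∀ m n : ℕ, 1 ≤ m → 8 * m ≤ n →
    ∀ u v : Site 3, u 0 = 0 → v 0 = 0 → (∀ i : Fin 3, |u i - v i| ≤ 2 * (m : ℤ)) →
    ∀ q B : ℝ, 0 < q →
      q ≤ Pc.real (openConnIn (Hs ∩ {x : Site 3 | ∀ i : Fin 3, |x i - u i| ≤ 3 * (m : ℤ)}) u v) →
      EdgeTwoArmBound (3 * m + 1) (n - 6 * m) B →
      Pc.real (distantPair u v n) * q ≤
        C * (m : ℝ) ^ 3 * B * q + C * (m : ℝ) ^ 6 * B / (criticalProbI 3 : ℝ)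

/-- `0` is the lex-min floor point of its (`n`-reaching) half-space cluster: the event whose
probability is the census residual `ν_n = E[1{tall}/|footprint|]` (horizontal mass transport). -/
def lexRootTall (n : ℕ) : Set (BondConfig (Site 3)) :=
  tallAt 0 n ∩ {ω | ∀ w : Site 3, w 0 = 0 → ω ∈ openConnIn Hs 0 w → (0 < w 1 ∨ (w 1 = 0 ∧ 0 ≤ w 2))}

/-- **Second lemma (root-pair density bound, no one-arm rate).**  The number of `n`-reaching
clusters lex-rooted in the floor patch `Λ_m ∩ ∂H` is at most the number `T'` of pairwise-disjoint
`n`-reaching clusters TOUCHING the patch, `T' ≤ |patch|` always, and `{T' ≥ 2} ⊆ ⋃_{u,v} distantPair u v n`;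
with `CerfComparison` and a wall-to-wall connection floor `q_m ≥ q` this yields
`(2m+1)² ν_n ≤ 1 + C m¹⁰ (m³ B + m⁶ B /(p_c q))`. -/
def RootPairDensity : Prop :=
  ∃ C : ℝ, 0 < C ∧ ∀ m n : ℕ, 1 ≤ m → 8 * m ≤ n → ∀ q B : ℝ, 0 < q →
    (∀ u v : Site 3, u 0 = 0 → v 0 = 0 → (∀ i : Fin 3, |u i| ≤ (m : ℤ)) → (∀ i : Fin 3, |v i| ≤ (m : ℤ)) →
      q ≤ Pc.real (openConnIn (Hs ∩ {x : Site 3 | ∀ i : Fin 3, |x i - u i| ≤ 3 * (m : ℤ)}) u v)) →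
    EdgeTwoArmBound (3 * m + 1) (n - 6 * m) B →
    (2 * (m : ℝ) + 1) ^ 2 * Pc.real (lexRootTall n) ≤
      1 + C * (m : ℝ) ^ 13 * B + C * (m : ℝ) ^ 16 * B / ((criticalProbI 3 : ℝ) * q)

/-- The bootstrap's exponent map (census `A_{2n} ≲ ν_n/n`, `ν_n ≲ m^{-2}` once `m^{P} A_n ≲ 1`):
`a ↦ 1 + 2a/(P+2)`, fixed point `1 + 2/P`.  Even the loss-free value `P = 4` (bare union over root
pairs) caps the certified exponent at `3/2 < 2.046 ≤ 2m - 3` for every admissible thinness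
exponent `m ≥ d_f` of crux B — the arithmetic behind "not a closing line". -/
theorem bootstrap_ceiling (P : ℝ) (hP : 4 ≤ P) : 1 + 2 / P ≤ 3 / 2 := by
  have hP0 : 0 < P := by linarith
  have h : 2 / P ≤ 1 / 2 := by
    rw [div_le_iff₀ hP0]
    linarith
  linarith

end

end Summit.CriticalPhenomena.PercolationContinuityZ3.Cruxes.BoundaryTwoArmDecay.CerfFreshRegion
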